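import Mathlib
import HarnessLib
import Summits.HubbardSuperconductivity.HubbardSuperconductivity.Theorems.KLProgrammeKLRegimeSplitEdgeFactsTransferModulusComplDeep
import Summits.HubbardSuperconductivity.HubbardSuperconductivity.Theorems.KLProgrammeKLRegimeSplitEdgeFactsComplMemberJetsV
import Summits.HubbardSuperconductivity.HubbardSuperconductivity.Theorems.KLProgrammeKLRegimeSplitEdgeFactsTransferModulusDeep
import Summits.HubbardSuperconductivity.HubbardSuperconductivity.Theorems.KLProgrammeKLRegimeSplitEdgeFactsSoftCount

/-!
# Route `KLProgramme` — edge facts for the pair masses ACROSS TRANSFERS, XI′: THE (D2)-DEEP ROW for the complementary members (row 25b `…TransferModulusComplDeep`)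
# with ABSTRACT band-jet constants `(v, κ)` — `klcdv_abs_sum_klTransferWeight_sub_pin_le` and its numeric form for `v, κ ≤ 20`

Cell gate-hubbard-kl, seat hubbard-kl-k3c1-p1 (g22; child-1 lineage); cure of the located «(s2)-JETS-COEFFNORM-KEYING».  Row 25b re-proved ONCE over the abstract jets
(section hypotheses `hjet`, `hjv : 4 ≤ v`, `hjκ : 4 ≤ κ`, each theorem taking exactly the ones it uses; chain `…RungJetsV` → `…RungJetsTransportV` → `…ComplMemberJetsV`):
`FrameOK → 0 < β ≤ L → 1 ≤ n → n+1 ≤ m → π/β ≤ 2Λ_n → v·|p_Q|_𝕋 ≤ Λ_n/16 → |Σ_p t_n[s_{n,m}](Q,p) − Σ_p t_n[s_{n,m}](0,p)| ≤ 30734·Λ_n·(3B₁ + 2B₂)` with the pointwise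
bounds `B₁, B₂` of `…ComplMemberJetsV` (polynomial in `v, κ`), and the NUMERIC form `≤ 1.413764·10¹¹·(|p_Q|_𝕋/Λ_n)²` now under `v ≤ 20`, `κ ≤ 20` (in place of
`IsAdmissibleFrame K`, which the flow frames violate at depth; the regime-native keying `v = 4 + 2A_K`, `κ = 4 + 8A_K` of `…BandJetsSup` meets `v, κ ≤ 20` as soon as
`A_K ≤ 2`, and `A_K = 2Gfr₀|U| + 2Gfr₁U² + Gfr₂·c/log 4` is small in the regime).  Statements and proofs are row 25b's verbatim with the substitution; the jet-free
lemmas (`klcd_two_mul_klScale_le`, `klcd_card_regions_le`, `klcd_term1/2_bound_le_numeric`) are imported, not restated.  Everything is proved; no definitions; nothing asserts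
any slot, stub, K3 or SC. [folklore]
-/

noncomputable section

namespace Summit.HubbardSuperconductivity.HubbardSuperconductivity.Theorems.KLRegimeSplit

set_option linter.dupNamespace false -- summit = problem name (single-conjunct summit), D-0017

open Real Finset Literature.MathematicalPhysics.QuantumLattice Literature.Probability.LatticeModels
open Literature.MathematicalPhysics.QuantumLattice.FermiRG
open Summit.HubbardSuperconductivity.HubbardSuperconductivity.Theorems.KLProgrammeLegKernels
open Summit.HubbardSuperconductivity.HubbardSuperconductivity.Theorems.TwoPointAssembly

section ComplDeep

variable {L M : ℕ} [NeZero L] (β μ : ℝ) (K : TrigPolyC4v)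
variable {v κ : ℝ}
  (hjet : (∀ k Q : TorusSite 2 L, |nambuXiCT L μ K (k + Q) - nambuXiCT L μ K k| ≤ v * klTorusNorm L Q) ∧
    (∀ k Q : TorusSite 2 L, |nambuXiCT L μ K (k - Q) - nambuXiCT L μ K k| ≤ v * klTorusNorm L Q) ∧
      ∀ k Q : TorusSite 2 L, |nambuXiCT L μ K (k + Q) - 2 * nambuXiCT L μ K k + nambuXiCT L μ K (k - Q)| ≤ κ * klTorusNorm L Q ^ 2)
  (hjv : 4 ≤ v) (hjκ : 4 ≤ κ)
include hjet hjv hjκ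

/-! ## §4 The two regions are counted by the soft count at scale `2Λ_n` -/

/-! ## §5 The (D2)-deep row for the complementary members -/

/-- **(D2)-deep for the complementary member `s_{n,m}`, `m ≥ n+1`** (`FrameOK`, `0 < β ≤ L`, `1 ≤ n`, `π/β ≤ 2Λ_n`, deep step
`v·|p_Q|_𝕋 ≤ Λ_n/16`): with `Λ = Λ_n`, `B₁` = the term-1 pointwise bound (`klcdv_term1_pointwise`), `B₂` = the term-2 pointwise bound
(`klcdv_term2_pointwise`), both `∝ |p_Q|_𝕋²`:
**`|Σ_p t_n[s_{n,m}](Q,p) − Σ_p t_n[s_{n,m}](0,p)| ≤ 30734·Λ_n·(3·B₁ + 2·B₂)`** — uniformly in `m`, `M`, `β`, `L`; in size `≲ 10⁸(κ′ + v′²)·(|p_Q|_𝕋/Λ_n)²`. [folklore] -/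
theorem klcdv_abs_sum_klTransferWeight_sub_pin_le [NeZero M] {R : RenConsts} {U : ℝ} {N : ℕ} (hK : FrameOK R U N μ K) (hβ : 0 < β) (hβL : β ≤ L)
    {n m : ℕ} (hn : 1 ≤ n) (hnm : n + 1 ≤ m) (hΛβ : Real.pi / β ≤ 2 * klScale klE0 n) (Q : TorusSite 2 L)
    (hdeep : v * klTorusNorm L Q ≤ klScale klE0 n / 16) :
    |∑ p, klTransferWeight L M β μ K n (softSymbolCompl L M β μ K n m) Q p - ∑ p, klTransferWeight L M β μ K n (softSymbolCompl L M β μ K n m) 0 p| ≤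
      30734 * klScale klE0 n *
        (3 * ((16 / 3 * (((klScale klE0 n + klScale klE0 n / 16) + klScale klE0 n / 2 / 2) * κ + v ^ 2) /
                    klScale klE0 n ^ 2 +
                  1408 / 9 * ((klScale klE0 n + klScale klE0 n / 16) + klScale klE0 n / 2 / 2) ^ 2 * v ^ 2 / klScale klE0 n ^ 4) *
                klTorusNorm L Q ^ 2 * (2 / (klScale klE0 n / 2)) +
              2 * (8 / 3 * (v * klTorusNorm L Q * (2 * (((klScale klE0 n + klScale klE0 n / 16) + klScale klE0 n / 2 / 2))) /
                  klScale klE0 n ^ 2) * (v * klTorusNorm L Q * (2 / (klScale klE0 n / 2)) ^ 2)) +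
            1 * ((κ + 2 * v ^ 2 * (2 / (klScale klE0 n / 2))) * (2 / (klScale klE0 n / 2)) ^ 2 * klTorusNorm L Q ^ 2)) +
          2 * (((16 / 3 * ((klScale klE0 n + klScale klE0 n / 4 / 2) * κ + v ^ 2) / klScale klE0 n ^ 2 +
                    1408 / 9 * (klScale klE0 n + klScale klE0 n / 4 / 2) ^ 2 * v ^ 2 / klScale klE0 n ^ 4) * (2 / (klScale klE0 n / 4)) +
                  2 * (8 / 3 * (v * (2 * (klScale klE0 n + klScale klE0 n / 4 / 2)) / klScale klE0 n ^ 2)) * v *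
                    (2 / (klScale klE0 n / 4)) ^ 2 +
                (κ + 2 * v ^ 2 * (2 / (klScale klE0 n / 4))) * (2 / (klScale klE0 n / 4)) ^ 2) *
              klTorusNorm L Q ^ 2)) := by
  classical
  set Λ := klScale klE0 n with hΛdef
  set σ := klTorusNorm L Q with hσdef
  have hΛ : 0 < Λ := klth_klScale_pos n
  have hv : 0 ≤ v := by linarith
  have hκ : 0 ≤ κ := by linarith
  have hσ : 0 ≤ σ := EngineV8.klband_klTorusNorm_nonneg (L := L) Q
  set φ := softSymbolCompl L M β μ K n m with hφdef
  set w := hubbardCutoffWeightCT L M β μ K Λ with hwdef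
  set G := propCT L M β μ K with hGdef
  -- the two pointwise bounds
  set B₁ := (16 / 3 * (((Λ + Λ / 16) + Λ / 2 / 2) * κ + v ^ 2) / Λ ^ 2 + 1408 / 9 * ((Λ + Λ / 16) + Λ / 2 / 2) ^ 2 * v ^ 2 / Λ ^ 4) * σ ^ 2 * (2 / (Λ / 2)) +
      2 * (8 / 3 * (v * σ * (2 * (((Λ + Λ / 16) + Λ / 2 / 2))) / Λ ^ 2) * (v * σ * (2 / (Λ / 2)) ^ 2)) +
    1 * ((κ + 2 * v ^ 2 * (2 / (Λ / 2))) * (2 / (Λ / 2)) ^ 2 * σ ^ 2) with hB₁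
  set B₂ := ((16 / 3 * ((Λ + Λ / 4 / 2) * κ + v ^ 2) / Λ ^ 2 + 1408 / 9 * (Λ + Λ / 4 / 2) ^ 2 * v ^ 2 / Λ ^ 4) * (2 / (Λ / 4)) +
        2 * (8 / 3 * (v * (2 * (Λ + Λ / 4 / 2)) / Λ ^ 2)) * v * (2 / (Λ / 4)) ^ 2 + (κ + 2 * v ^ 2 * (2 / (Λ / 4))) * (2 / (Λ / 4)) ^ 2) * σ ^ 2 with hB₂
  have hB₁0 : 0 ≤ B₁ := by positivity
  have hB₂0 : 0 ≤ B₂ := by positivity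
  -- regions
  set T := (univ : Finset (FreqMomentum L M)).filter fun k => w k ≠ 0 ∧ (φ (k.1, k.2 + Q) ≠ 0 ∨ φ k ≠ 0 ∨ φ (k.1, k.2 - Q) ≠ 0) with hT
  set S := (univ : Finset (FreqMomentum L M)).filter fun k => φ k ≠ 0 ∧ (w (k.1, k.2 + Q) ≠ 0 ∨ w k ≠ 0 ∨ w (k.1, k.2 - Q) ≠ 0) with hS
  obtain ⟨hTc, hSc⟩ := klcd_card_regions_le (M := M) β μ K hK hβ hβL hn hnm hΛβ Q
  -- the two localised summands
  set P₁ : FreqMomentum L M → ℝ := fun k =>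
    ‖(w k : ℂ) * G k‖ * ‖(φ (k.1, k.2 + Q) : ℂ) * G (k.1, k.2 + Q) - 2 * ((φ (k.1, k.2) : ℂ) * G (k.1, k.2)) + (φ (k.1, k.2 - Q) : ℂ) * G (k.1, k.2 - Q)‖ with hP₁
  set P₂ : FreqMomentum L M → ℝ := fun k =>
    ‖(φ k : ℂ) * G k‖ * ‖(w (k.1, k.2 + Q) : ℂ) * G (k.1, k.2 + Q) - 2 * ((w (k.1, k.2) : ℂ) * G (k.1, k.2)) + (w (k.1, k.2 - Q) : ℂ) * G (k.1, k.2 - Q)‖ with hP₂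
  have h1 : ∑ k, P₁ k ≤ T.card * (2 / Λ * B₁) := by
    refine klta_sum_le_card_mul P₁ T (2 / Λ * B₁) (fun k hk => ?_) (fun k hk => ?_)
    · rw [hT, mem_filter, not_and_or] at hk
      rcases hk with hk | hk
      · exact absurd (mem_univ k) hk
      rw [not_and_or, not_ne_iff] at hk
      rcases hk with hk | hk
      · simp only [hP₁, hk, Complex.ofReal_zero, zero_mul, norm_zero]
      · push Not at hk
        obtain ⟨a, b, c⟩ := hk
        have b' : φ (k.1, k.2) = 0 := b
        simp only [hP₁, a, b', c, Complex.ofReal_zero, zero_mul, mul_zero, sub_zero, add_zero, norm_zero]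
    · rw [hT, mem_filter] at hk
      obtain ⟨-, hwk, hφ3⟩ := hk
      obtain ⟨ν, p⟩ := k
      have hpt := klcdv_term1_pointwise β μ K hjet hjv hjκ hβ hnm Q hdeep ν p hwk hφ3
      have hw0 : 0 ≤ w (ν, p) := (salmhoferCutoff_mem_Icc _).1
      have hhard : ‖(w (ν, p) : ℂ) * G (ν, p)‖ ≤ 2 / Λ := by
        rw [klta_norm_ofReal_mul, abs_of_nonneg hw0]
        exact hubbardCutoffWeightCT_mul_norm_propCT_le β μ K hΛ (ν, p)
      simp only [hP₁]
      exact mul_le_mul hhard hpt (norm_nonneg _) (by positivity)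
  have h2 : ∑ k, P₂ k ≤ S.card * (1 / (Λ / 4) * B₂) := by
    refine klta_sum_le_card_mul P₂ S (1 / (Λ / 4) * B₂) (fun k hk => ?_) (fun k hk => ?_)
    · rw [hS, mem_filter, not_and_or] at hk
      rcases hk with hk | hk
      · exact absurd (mem_univ k) hk
      rw [not_and_or, not_ne_iff] at hk
      rcases hk with hk | hk
      · simp only [hP₂, hk, Complex.ofReal_zero, zero_mul, norm_zero]
      · push Not at hk
        obtain ⟨a, b, c⟩ := hk
        have b' : w (k.1, k.2) = 0 := b
        simp only [hP₂, a, b', c, Complex.ofReal_zero, zero_mul, mul_zero, sub_zero, add_zero, norm_zero]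
    · rw [hS, mem_filter] at hk
      obtain ⟨-, hφk, hw3⟩ := hk
      obtain ⟨ν, p⟩ := k
      obtain ⟨hsoftline, hpt⟩ := klcdv_term2_pointwise β μ K hjet hjv hjκ hβ hnm Q hdeep ν p hφk hw3
      simp only [hP₂]
      rw [klta_norm_ofReal_mul]
      exact mul_le_mul hsoftline hpt (norm_nonneg _) (by positivity)
  -- row 16 and the split
  obtain ⟨hev, hev'⟩ := klcd_soft_even (L := L) (M := M) β μ K n m
  have hmain := abs_sum_klTransferWeight_sub_pin_le β μ K hβ.le n hev hev' Q
  have hsplit : ∑ ν : MatsubaraIdx M, ∑ p : TorusSite 2 L,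
      (‖(w (ν, p) : ℂ) * G (ν, p)‖ * ‖(φ (ν, p + Q) : ℂ) * G (ν, p + Q) - 2 * ((φ (ν, p) : ℂ) * G (ν, p)) + (φ (ν, p - Q) : ℂ) * G (ν, p - Q)‖ +
        ‖(φ (ν, p) : ℂ) * G (ν, p)‖ * ‖(w (ν, p + Q) : ℂ) * G (ν, p + Q) - 2 * ((w (ν, p) : ℂ) * G (ν, p)) + (w (ν, p - Q) : ℂ) * G (ν, p - Q)‖) =
      ∑ k, P₁ k + ∑ k, P₂ k := by
    rw [← sum_add_distrib, klta_sum_sum_eq_sum_prod]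
  have hc : 0 ≤ 1 / 2 * (β * (L : ℝ) ^ 2)⁻¹ := by positivity
  have hL : (1 : ℝ) ≤ L := by exact_mod_cast Nat.one_le_iff_ne_zero.2 (NeZero.ne L)
  have hβL2 : 0 < β * (L : ℝ) ^ 2 := by positivity
  refine hmain.trans ?_
  rw [hsplit]
  -- numeric assembly: `#T ≤ 3N`, `#S ≤ N`, `N = (15367/2)(2Λ)²βL²`
  have e1 : (T.card : ℝ) * (2 / Λ * B₁) ≤ 3 * (15367 / 2 * (2 * Λ) ^ 2 * (β * (L : ℝ) ^ 2)) * (2 / Λ * B₁) :=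
    mul_le_mul_of_nonneg_right hTc (by positivity)
  have e2 : (S.card : ℝ) * (1 / (Λ / 4) * B₂) ≤ 15367 / 2 * (2 * Λ) ^ 2 * (β * (L : ℝ) ^ 2) * (1 / (Λ / 4) * B₂) :=
    mul_le_mul_of_nonneg_right hSc (by positivity)
  have hid : 1 / 2 * (β * (L : ℝ) ^ 2)⁻¹ *
      (3 * (15367 / 2 * (2 * Λ) ^ 2 * (β * (L : ℝ) ^ 2)) * (2 / Λ * B₁) + 15367 / 2 * (2 * Λ) ^ 2 * (β * (L : ℝ) ^ 2) * (1 / (Λ / 4) * B₂)) =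
      30734 * Λ * (3 * B₁ + 2 * B₂) := by
    field_simp
    ring
  calc 1 / 2 * (β * (L : ℝ) ^ 2)⁻¹ * (∑ k, P₁ k + ∑ k, P₂ k)
      ≤ 1 / 2 * (β * (L : ℝ) ^ 2)⁻¹ *
          (3 * (15367 / 2 * (2 * Λ) ^ 2 * (β * (L : ℝ) ^ 2)) * (2 / Λ * B₁) + 15367 / 2 * (2 * Λ) ^ 2 * (β * (L : ℝ) ^ 2) * (1 / (Λ / 4) * B₂)) :=
        mul_le_mul_of_nonneg_left (by linarith) hc
    _ = 30734 * Λ * (3 * B₁ + 2 * B₂) := hid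

/-! ## §6 Numeric form for jet constants `v, κ ≤ 20` -/

/-- **(D2)-deep, numeric form for jet constants `v, κ ≤ 20`**: `FrameOK`, `v ≤ 20`, `κ ≤ 20`, `0 < β ≤ L`, `1 ≤ n`, `n + 1 ≤ m`, `π/β ≤ 2Λ_n`, deep step ⟹
**`|Σ_p t_n[s_{n,m}](Q,p) − Σ_p t_n[s_{n,m}](0,p)| ≤ 1.413764·10¹¹·(|p_Q|_𝕋/Λ_n)²`** (`30734·(3·6·10⁵ + 2·1.4·10⁶)`). [folklore] -/
theorem klcdv_abs_sum_klTransferWeight_sub_pin_le_numeric [NeZero M] {R : RenConsts} {U : ℝ} {N : ℕ} (hK : FrameOK R U N μ K) (hv20 : v ≤ 20) (hκ20 : κ ≤ 20)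
    (hβ : 0 < β) (hβL : β ≤ L) {n m : ℕ} (hn : 1 ≤ n) (hnm : n + 1 ≤ m) (hΛβ : Real.pi / β ≤ 2 * klScale klE0 n) (Q : TorusSite 2 L)
    (hdeep : v * klTorusNorm L Q ≤ klScale klE0 n / 16) :
    |∑ p, klTransferWeight L M β μ K n (softSymbolCompl L M β μ K n m) Q p - ∑ p, klTransferWeight L M β μ K n (softSymbolCompl L M β μ K n m) 0 p| ≤
      141376400000 * (klTorusNorm L Q / klScale klE0 n) ^ 2 := by
  have h := klcdv_abs_sum_klTransferWeight_sub_pin_le (M := M) β μ K hjet hjv hjκ hK hβ hβL hn hnm hΛβ Q hdeep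
  have hΛ : 0 < klScale klE0 n := klth_klScale_pos n
  have hΛ' : klScale klE0 n ≤ 3 / 80 := (klScale_klE0_lt_tube n).le
  have hv0 : 0 ≤ v := by linarith
  have hκ0 : 0 ≤ κ := by linarith
  have h1 := klcd_term1_bound_le_numeric (σ := klTorusNorm L Q) hv0 (by linarith) hκ0 (by linarith) hΛ hΛ'
  have h2 := klcd_term2_bound_le_numeric (σ := klTorusNorm L Q) hv0 (by linarith) hκ0 (by linarith) hΛ hΛ'
  refine h.trans ?_
  have hid : 141376400000 * (klTorusNorm L Q / klScale klE0 n) ^ 2 =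
      30734 * klScale klE0 n * (3 * (600000 * klTorusNorm L Q ^ 2 / klScale klE0 n ^ 3) + 2 * (1400000 * klTorusNorm L Q ^ 2 / klScale klE0 n ^ 3)) := by
    field_simp
    ring
  rw [hid]
  exact mul_le_mul_of_nonneg_left (by linarith) (by positivity)

end ComplDeep

end Summit.HubbardSuperconductivity.HubbardSuperconductivity.Theorems.KLRegimeSplit

end

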